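import Mathlib
import HarnessLib
import Summits.NavierStokesRegularity.NavierStokesRegularity.Theorems.PoloidalWindowRigidity.Negative.TriSheetTimeRate
import Summits.NavierStokesRegularity.NavierStokesRegularity.Theorems.PoloidalWindowRigidity.Negative.TriWaveProfile

/-!
# Crux `PoloidalWindowRigidity` (K2, stmt-NavierStokesRegularity-19708) — negative side:
# the time-derivative class rate removes EVERY log-drifted profile

Negative-side support (refuter seat ns-regularity-refuter1 gen 2; D-0081 §C), sequel of `…Negative.TriSheetTimeRate`
(which treats the three-sheet profile by an explicit evaluation).

Generic mechanism.  For any `U : E³ → E³` differentiable at a point `η` with `DU(η)e₁ ≠ 0`, the log-drifted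
profile `v(t,x) = c_t U(c_t x + log(−t)e₁)` violates the time-derivative class rate
«(T) `‖∂_t v(t,y)‖ ≤ K/((−t)√(−t))`» (the conclusion of
`…Theorems.PoloidalWindowDoorPoloidalWindowRigidityClassSpaceTimeRates.exists_deriv_rate_of_class`, p503432) for every
constant `K`: at the point `y_t` drifted onto `η`,
`∂_t v(t,y_t) = c_t³·(½DU(η)η + ½U(η) − (log(−t)/2 + 1)·DU(η)e₁)`, and `log(−t)` is at our disposal
(`drift_timeDeriv_exceeds`).  Corollaries: (T) fails for the cellular drift profile `driftProfile`
(`…Negative.DriftProfile`, K-14) and the three-wave profile `triProfile` (`…Negative.TriWaveProfile`, K-28) — so the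
clause (T), dischargeable from hypotheses 1–3 of the residue stub, empties the whole (M)-free catalogue of this lane
(cells K-3 are not even Type-I-drifted; sheets: `sheetProfile_not_timeDerivRate`).

WHAT THIS IS NOT: not a claim about Navier–Stokes and not a refutation of any registered stub; kinematics of explicit
non-mild profiles. [folklore]
-/

noncomputable section

-- the summit and its single sub-problem share the name (CONVENTIONS §1), as in every Theorems file
set_option linter.dupNamespace false

namespace Summit.NavierStokesRegularity.NavierStokesRegularity.Theorems.PoloidalWindowRigidity.Negative

open MeasureTheory Set Function Filter Topology Metric
open scoped RealInnerProductSpace InnerProductSpace ENNReal NNReal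
open Literature.Analysis Literature.Analysis.FluidPDE

/-! ## The generic drift mechanism -/

/-- **Log drift versus the time-derivative rate.**  If `U` is differentiable at `η` with `DU(η)e₁ ≠ 0`, then for
every `K` there are `t < 0` and `y` with `‖∂_τ (c_τ U(c_τ y + log(−τ)e₁))|_{τ=t}‖ > K/((−t)√(−t))`. [folklore] -/
theorem drift_timeDeriv_exceeds (U : EuclideanSpace ℝ (Fin 3) → EuclideanSpace ℝ (Fin 3))
    (η : EuclideanSpace ℝ (Fin 3)) (hU : DifferentiableAt ℝ U η)
    (hd : fderiv ℝ U η (EuclideanSpace.single (1 : Fin 3) (1 : ℝ)) ≠ 0) (K : ℝ) :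
    ∃ t < 0, ∃ y : EuclideanSpace ℝ (Fin 3),
      K / ((-t) * Real.sqrt (-t)) < ‖deriv (fun τ => cellAmp τ • U (driftShift τ y)) t‖ := by
  set d : EuclideanSpace ℝ (Fin 3) := fderiv ℝ U η (EuclideanSpace.single (1 : Fin 3) (1 : ℝ)) with hd_def
  set a : EuclideanSpace ℝ (Fin 3) := (1 / 2 : ℝ) • fderiv ℝ U η η + (1 / 2 : ℝ) • U η with ha
  have hδ : 0 < ‖d‖ := norm_pos_iff.2 hd
  -- the multiplier `s = log(−t)/2 + 1` we want, and the time realising it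
  set s : ℝ := (|K| + ‖a‖ + 1) / ‖d‖ with hs
  have hsd : s * ‖d‖ = |K| + ‖a‖ + 1 := by
    rw [hs]
    field_simp
  set L : ℝ := 2 * (s - 1) with hL
  set t : ℝ := -Real.exp L with ht_def
  have ht : t < 0 := by
    have := Real.exp_pos L
    linarith
  have hlog : Real.log (-t) = L := by rw [ht_def, neg_neg, Real.log_exp]
  have hc : 0 < cellAmp t := cellAmp_pos ht
  -- the point drifted onto `η`
  set y : EuclideanSpace ℝ (Fin 3) := (cellAmp t)⁻¹ • (η - L • EuclideanSpace.single (1 : Fin 3) (1 : ℝ)) with hy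
  have hξ : driftShift t y = η := by
    show cellAmp t • y + Real.log (-t) • EuclideanSpace.single (1 : Fin 3) (1 : ℝ) = η
    rw [hy, smul_smul, mul_inv_cancel₀ hc.ne', one_smul, hlog, sub_add_cancel]
  refine ⟨t, ht, y, ?_⟩
  -- the time derivative at `(t, y)`
  have hder := hasDerivAt_driftShift ht y
  have hF : HasDerivAt (fun τ => cellAmp τ • U (driftShift τ y))
      (cellAmp t • fderiv ℝ U η ((cellAmp t ^ 3 / 2) • y + (-(cellAmp t ^ 2)) • EuclideanSpace.single (1 : Fin 3) (1 : ℝ)) +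
        (cellAmp t ^ 3 / 2) • U η) t := by
    have hUη : HasFDerivAt U (fderiv ℝ U η) (driftShift t y) := by
      rw [hξ]
      exact hU.hasFDerivAt
    refine ((hasDerivAt_cellAmp ht).smul (hUη.comp_hasDerivAt t hder)).congr_deriv ?_
    simp only [Function.comp_apply, hξ]
  rw [hF.deriv]
  -- normal form `c³ • (a − s • d)`
  have hξ' : (cellAmp t ^ 3 / 2) • y + (-(cellAmp t ^ 2)) • EuclideanSpace.single (1 : Fin 3) (1 : ℝ) =
      (cellAmp t ^ 2 / 2) • (η - L • EuclideanSpace.single (1 : Fin 3) (1 : ℝ)) + (-(cellAmp t ^ 2)) • EuclideanSpace.single (1 : Fin 3) (1 : ℝ) := by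
    rw [hy, smul_smul]
    congr 1
    rw [show cellAmp t ^ 3 / 2 * (cellAmp t)⁻¹ = cellAmp t ^ 2 / 2 by field_simp]
  have hV : cellAmp t • fderiv ℝ U η ((cellAmp t ^ 3 / 2) • y + (-(cellAmp t ^ 2)) • EuclideanSpace.single (1 : Fin 3) (1 : ℝ)) +
      (cellAmp t ^ 3 / 2) • U η = cellAmp t ^ 3 • (a - s • d) := by
    rw [hξ']
    simp only [map_add, map_smul, map_sub]
    rw [ha, hd_def, hL]
    module
  rw [hV, norm_smul, Real.norm_eq_abs, abs_of_pos (by positivity : 0 < cellAmp t ^ 3), div_eq_mul_inv,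
    ← cellAmp_pow_three ht]
  -- `‖a − s d‖ ≥ s‖d‖ − ‖a‖ = |K| + 1 > K`
  have hsn : 0 ≤ s := by
    rw [hs]
    positivity
  have hlow : |K| + 1 ≤ ‖a - s • d‖ := by
    have h1 := norm_sub_norm_le (s • d) a
    rw [norm_smul, Real.norm_eq_abs, abs_of_nonneg hsn, hsd, ← norm_neg (s • d - a), neg_sub] at h1
    linarith
  have hc3 : 0 < cellAmp t ^ 3 := by positivity
  calc K * cellAmp t ^ 3 ≤ |K| * cellAmp t ^ 3 := by nlinarith [le_abs_self K]
    _ < cellAmp t ^ 3 * (|K| + 1) := by nlinarith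
    _ ≤ cellAmp t ^ 3 * ‖a - s • d‖ := by nlinarith

/-! ## Corollaries: the cellular drift profile and the three-wave profile -/

/-- `DV(0, π/2, 0) e₁ ≠ 0` for the cellular field. [folklore] -/
theorem fderiv_cellField_single_one_ne_zero :
    fderiv ℝ cellField ((Real.pi / 2) • EuclideanSpace.single (1 : Fin 3) (1 : ℝ))
      (EuclideanSpace.single (1 : Fin 3) (1 : ℝ)) ≠ 0 := by
  intro h
  have h1 := congrArg (fun w : EuclideanSpace ℝ (Fin 3) => w 1) h
  simp [fderiv_cellField, cellDeriv_apply_one, PiLp.smul_apply] at h1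

/-- **(T) fails for the cellular drift profile** (`…Negative.DriftProfile`), for every constant. [folklore] -/
theorem driftProfile_timeDeriv_exceeds (K : ℝ) :
    ∃ t < 0, ∃ y : EuclideanSpace ℝ (Fin 3),
      K / ((-t) * Real.sqrt (-t)) < ‖deriv (fun τ => driftProfile τ y) t‖ :=
  drift_timeDeriv_exceeds cellField _ (hasFDerivAt_cellField _).differentiableAt
    fderiv_cellField_single_one_ne_zero K

/-- The clause (T), in the shape of `exists_deriv_rate_of_class`, is false for `driftProfile`. [folklore] -/
theorem driftProfile_not_timeDerivRate :
    ¬ ∃ K : ℝ, 0 ≤ K ∧ ∀ t < 0, ∀ y : EuclideanSpace ℝ (Fin 3),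
        ‖deriv (fun τ => driftProfile τ y) t‖ ≤ K / ((-t) * Real.sqrt (-t)) := by
  rintro ⟨K, -, hK⟩
  obtain ⟨t, ht, y, hlt⟩ := driftProfile_timeDeriv_exceeds K
  exact absurd (hK t ht y) (not_le.2 hlt)

/-- `DT(0, π/2, 0) e₁ ≠ 0` for the three-wave field. [folklore] -/
theorem fderiv_triField_single_one_ne_zero :
    fderiv ℝ triField ((Real.pi / 2) • EuclideanSpace.single (1 : Fin 3) (1 : ℝ))
      (EuclideanSpace.single (1 : Fin 3) (1 : ℝ)) ≠ 0 := by
  intro h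
  have h1 := congrArg (fun w : EuclideanSpace ℝ (Fin 3) => w 1) h
  simp [fderiv_triField, triDeriv_apply_one, PiLp.smul_apply] at h1
  norm_num at h1

/-- **(T) fails for the three-wave profile** (`…Negative.TriWaveProfile`), for every constant. [folklore] -/
theorem triProfile_timeDeriv_exceeds (K : ℝ) :
    ∃ t < 0, ∃ y : EuclideanSpace ℝ (Fin 3),
      K / ((-t) * Real.sqrt (-t)) < ‖deriv (fun τ => triProfile τ y) t‖ :=
  drift_timeDeriv_exceeds triField _ (hasFDerivAt_triField _).differentiableAt
    fderiv_triField_single_one_ne_zero K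

/-- The clause (T), in the shape of `exists_deriv_rate_of_class`, is false for `triProfile`. [folklore] -/
theorem triProfile_not_timeDerivRate :
    ¬ ∃ K : ℝ, 0 ≤ K ∧ ∀ t < 0, ∀ y : EuclideanSpace ℝ (Fin 3),
        ‖deriv (fun τ => triProfile τ y) t‖ ≤ K / ((-t) * Real.sqrt (-t)) := by
  rintro ⟨K, -, hK⟩
  obtain ⟨t, ht, y, hlt⟩ := triProfile_timeDeriv_exceeds K
  exact absurd (hK t ht y) (not_le.2 hlt)

end Summit.NavierStokesRegularity.NavierStokesRegularity.Theorems.PoloidalWindowRigidity.Negative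

end
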